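import Summits.Ventures.PercRepro.CatStar
import Summits.Ventures.PercRepro.StarGadgetFNonneg
import Summits.Ventures.PercRepro.StarGadgetFPrimeNonneg

/-!
# The star control of the branch-catalogue theorem — `catPoly = F / F′` (module 2 of 2)

The catalogue polynomial of the STAR CATALOGUE with `p, q, r, s` hubs of the types `ab, ac, bc, abc`
and the edge `c – x` present iff `cx` is mine-3's exponential polynomial `F p q r s` (with the edge)
or `F' p q r s` (without it) — the polynomials of the star-gadget theorem (`StarGadgetF`,
`StarGadgetGraphDelta`), re-derived here from the branch-catalogue theorem with NO graph argument:
the universal Möbius coefficients and the per-type bases are kernel-checked numerals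
(`CatStar`), the assembly is `ring`.  This is the consistency check of the catalogue theorem
(`cat_delta`) against the star-gadget theorem (`starGadget_delta`): both give the same slack.
-/

namespace PercRepro.CatGraph

open StarGadgetGraph

/-- **The star control**: the catalogue polynomial of the star catalogue is `F` / `F'`. -/
theorem catPoly_star (cx : Bool) (p q r s : ℕ) :
    catPoly locStar (mStar cx p q r s) =
      if cx then StarGadget.F p q r s else StarGadget.F' p q r s := by
  rw [catPoly_eq, Fintype.sum_option, Fin.sum_univ_three]
  simp only [sum_ev, evSign]
  rw [cellStar_none_o1, cellStar_none_o2, cellStar_none_bad, cellStar_a_o1, cellStar_a_o2, cellStar_a_bad, cellStar_b_o1, cellStar_b_o2, cellStar_b_bad, cellStar_c_o1, cellStar_c_o2, cellStar_c_bad]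
  cases cx
  · simp only [Bool.false_eq_true, ↓reduceIte, pow_zero, mul_one]
    unfold StarGadget.F'
    ring
  · simp only [↓reduceIte, pow_one]
    unfold StarGadget.F
    ring

/-- **Corollary (the catalogue theorem specialised to the star gadget)**: the D-free inequality on
the star catalogue's gadget, from `cat_dFreeIneq` and the nonnegativity of `F` / `F'`. -/
theorem catStar_dFreeIneq (cx : Bool) (p q r s : ℕ) :
    (catGadget locStar (mStar cx p q r s)).DFreeIneq (vm 0) (vm 1) (vm 2) := by
  apply cat_dFreeIneq
  rw [catPoly_star]
  cases cx
  · exact StarGadget.F'_nonneg p q r s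
  · exact StarGadget.F_nonneg p q r s

end PercRepro.CatGraph
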